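import Summits.QuantumFields.YangMills.Theorems.BalabanUVNodesN12FlatHndHarmonicLetter
import Literature.MathematicalPhysics.QuantumFieldTheory.Balaban1983to89.Node00.MultiScaleFibreChartB
import Summits.QuantumFields.YangMills.Theorems.BalabanUVNodesN12FlatFibreNullSpaceDetSetB
import HarnessLib

/-!
# BalabanUVNodes ∕ N12 — (β)♭: THE HARMONIC LETTER (L♭) FOR THE RECORD's `𝐁_k(Z)`, EVERY `Z` — the loop letter (L) of `N12FlatFibreNullSpaceDetSet` is replaced by what it was used for («a — **BOND-DATUM EDITION** (`…N12FlatHndHarmonicLetterB`, USED DECLARATIONS ONLY)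

The print-datum ([Balaban1984PropagatorsII] (2.3)) (γ) twin of `Summits/…/Theorems/BalabanUVNodesN12FlatHndHarmonicLetter.lean`: the declarations of the parent whose STATEMENT reads the determining datum
(`exists_locConstGauge_of_plaq_eq_zero_of_iterLin_eq_zero_of_harmonic`) and which N12's junction of record v14ᴸ uses (dag-n12-c g35 probe-2 census `UsedConstsN12RoadTyped2`, THEOREMS block), re-typed over a
BOND-LEVEL datum `𝔅 : BDetSet` (F0a `B15DeterminingSetsB`) and dag-n12-c's bond-datum chart `Node00.msChartB` (✓p774329; `msChart 𝐁 = msChartB (bondsDet 𝐁)` by `rfl`).  GENERATOR twin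
(this seat's `work/g32/gen_thm.py`, block-extracted from the parent's tree bytes): namespace `…N12FlatHndHarmonicLetterB`, SAME short names, `DetSet ↦ BDetSet`, `AgreeOn 𝐁 ↦ AgreeOnB 𝔅`,
`IsMinimizer ↦ IsMinimizerB`, `bondsOf (𝐁 j) ↦ 𝔅 j`, `msChart ∕ constrCard ∕ constrEnum ∕ ConstrSet ↦ …B`, NODE 00 chart lemmas `…msChart… ↦ …msChartB…`; proofs VERBATIM; the parent's
datum-free declarations REUSED BY NAME (`open`), never copied (private plumbing excepted, №366 R2).  The parent's (b) statements are the instances `𝔅 := bondsDet 𝐁`.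

Cell `pub-ymgap` (HUMAN RULINGS D-0062 ∕ D-0149), seat `pub-ymgap-dag-n12-d` g32 (R134 N12 [B15] s2; the (ii) Theorems-side re-key of N12's road at print's [II] (2.3) datum — director-ym №338 ∕
№343 (E1)(iii-b), FLAG №16 ∕ ruling (α); dag-n12-c DESIGN memo a793b2ebc0b803bf (ii); `N12-ROAD-TWIN-ORDER-2026-08-30.md`).  Count-neutral helper of K1⁹ `stmt-QuantumFields-27364`,
`--kind proof --supports … --as helper`.  THEOREMS ONLY (0 `def`, 0 `instance`, 0 `sorry`).

HONEST FRAMING (director-ym №338 (5)).  PURELY ADDITIVE: the parent stays landed and true on its own text; nothing in it is edited; no displayed premise of any consumer is deleted or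
weakened; every hypothesis of the parent stays a hypothesis.  Nothing of Bałaban's analysis asserted; N12 NOT discharged; K0⁷ ∕ K1⁹ NOT closed; counts unmoved (typed 28∕28 · discharged
8∕27, A 8∕28; K 1∕4); one finite 𝕋⁴ programme at fixed ε — R4 closes the conditional rung `BalabanLadder.UV` only; NOT the Yang–Mills mass gap (Clay); nothing continuum ∕ ℝ⁴ ∕ OS.

PARENT's DOCSTRING (the mathematics and the citations; read the site-level `𝐁` as the bond datum `𝔅`):
# BalabanUVNodes ∕ N12 — (β)♭: THE HARMONIC LETTER (L♭) FOR THE RECORD's `𝐁_k(Z)`, EVERY `Z` — the loop letter (L) of `N12FlatFibreNullSpaceDetSet` is replaced by what it was used for («a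
# constrained affine potential `φ(c₊) − φ(c₋) + L^j·A = 0` has `A = 0`»), and (L♭) is PROVED for `Bj M₁ Z k` with NO hypothesis on `Z`: the flat real `hnondeg` letter on the
# `𝐁_k(Z)`-adapted hierarchical axial slice now carries no geometric letter and no line-miss hypothesis

Cell `pub-ymgap` (HUMAN RULINGS D-0062 ∕ D-0149), WIDTH SEAT `pub-ymgap-dag-n12-w3` g2 (node N12 = [B15]; key K1⁷ `stmt-QuantumFields-20542`, `--supports … --as helper`; count-neutral).  THEOREMS ONLY.
WHY.  `N12FlatHndConnLetter.hnondeg_real_flat_hierAxial_Bj` still displayed `hline` («one lattice line per direction misses `Z`»), the sufficient condition for the loop letter (L); a large-field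
region `Z` wrapping around the torus violates it (and (L) — a full `μ`-loop of constrained bonds at ONE level — may then fail).  But (L) only served to kill the constant vector part `A` of a
curl-free constrained field `X = dφ + A` (`N12FlatFibreNullSpace.exists_grad_add_dirConst_of_plaq_eq_zero_matrix`), and THAT holds for every `Z`: with the label potential `Λ(x) = Σ_ν x_ν·A_ν`
(labels `x_ν ∈ [0, N₀)`), `Ψ = φ + Λ` is constant along every non-wrapping constrained bond and jumps by `−N₀·A_μ` along the wrapping ones (§4, `val_embIter`); the potential-at-the-top argument
of `N12FlatHndConnLetter.T_shift_eq` run with a seam monodromy `w` (§2: the one constrained bond used in each case is adjacent to the fine bond, so it wraps exactly when the fine bond does, §1;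
in-block steps never wrap) transfers the law to the fine bonds, and once around the fine torus (§3) gives `w_μ = N₀·A_μ = 0` (§4), i.e. `A = 0` over `ℂ` (§5 ★★★ `harmonic_Bj`).

CONTENTS.  §1 `val_iterBlockOf_add_one_eq_of_wrap`, `iterBlockOf_shift_ne_of_wrap`, ★ `wrap_iff_of_iterBlockOf_shift`, `not_wrap_of_iterBlockOf_shift_eq`; §2 ★★ `T_shift_add_seam_eq`; §3 ★ `seam_eq_zero_of_shift_law`;
§4 `embIter_shift_apply_of_ne`, ★★★ `sitesPerDir_nsmul_eq_zero_of_constr_Bj`; §5 ★★★ `harmonic_Bj`, ★★ `exists_locConstGauge_of_plaq_eq_zero_of_iterLin_eq_zero_of_harmonic` (any determining set, (L♭) for (L)),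
★★★ `eq_zero_of_fderiv_msChart_one_eq_zero_of_hierAxial_of_harmonic` ((β)♭ on the `𝐁`-adapted hierarchical axial slice modulo (L♭), (Cov), (C) — matrix-level throughout), ★★★ `hnondeg_real_flat_hierAxial_Bj_allZ`
(the record's shape for `𝐁_k(Z)`, EVERY `Z`: hypotheses left `1 ≤ M₁`, `1 ≤ k ≤ m + K`, cover divisibility, the `Q`-recursion data, slice membership, the kernel letter `hker`, the bilinear hypothesis `hq`).

HONEST FRAMING.  Pure lattice geometry ∕ linear algebra at the FLAT configuration (`U₀ = 1`); REAL statements; the analytic letters (`hker`, `hq`), `honto` for the `𝐁`-adapted slice (upstream),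
the near-flat backgrounds `U₀ ≠ 1` and the complexification stay displayed ∕ with their owners; nothing of Bałaban's estimates is asserted; N12 NOT discharged; K1⁷ NOT closed; counts unmoved
(typed 28∕28 · discharged 5∕27); one finite 𝕋⁴ programme at fixed ε — R4 closes the conditional rung `BalabanLadder.UV` only; the Yang–Mills mass gap (Clay) is NOT proved by any of this;
nothing continuum ∕ ℝ⁴ ∕ OS.
-/

noncomputable section

namespace Summit.QuantumFields.YangMills.BalabanUVNodes.N12FlatHndHarmonicLetterB

open Literature.MathematicalPhysics.QuantumFieldTheory.Balaban1983to89.B15DeterminingSetsB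

open Literature.MathematicalPhysics.QuantumFieldTheory.Balaban1983to89
open B15DeterminingSets
open B5Eq118OneStroke (iterBlockOf val_iterBlockOf)
open B6QGQTestBumpsKLevelV1 (val_shift_self')
open Summit.QuantumFields.YangMills.Theorems.Prop7FlatHolonomy (sitesPerDir_zero_eq_mul_pow)

section
variable {P : Params}
open scoped Classical
open scoped BigOperators Matrix.Norms.L2Operator Topology
open T4Continuum (T4Family)
open BlockAveragingEMLLinearised (linAvg)
open T4AdjointCovarianceUnitary (lieSU)
open B10Eq27TorusAxialLog (axialT)
open Node00
open Literature.MathematicalPhysics.QuantumFieldTheory.Balaban1983to89.B14.Eq213DetSet (Bj)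
open Literature.MathematicalPhysics.QuantumFieldTheory.Balaban1983to89.B14.Eq213MaximalDomains (side)
open Summit.QuantumFields.YangMills.Theorems.Prop7CombGauge (iterLin_add)
open Summit.QuantumFields.YangMills.Theorems.Prop7AvgLinearisation (iterLin_grad)
open N12FlatFibreNullSpace (iterLin_dirConst exists_grad_add_dirConst_of_plaq_eq_zero_matrix)
open Summit.QuantumFields.YangMills.BalabanUVNodes.N12FlatFibreNullSpaceDetSetB (iterLin_eq_zero_of_fderiv_msChart_one_eq_zero_detSet)
open N12FlatChartHnd (coe_plaq_eq_zero_of_deriv_deriv_eq_zero)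
open N12FlatHierAxialHndDetSet (grad_eq_zero_of_hierAxial_of_locConst)
variable {n : Type*} {M₁ : ℕ} {Z : Set (Site P 0)} {k : ℕ}

/-- ★★ **THE LOCALLY-CONSTANT GAUGE UNDER THE HARMONIC LETTER** (`N12FlatFibreNullSpaceDetSet.exists_locConstGauge_of_plaq_eq_zero_of_iterLin_eq_zero_detSet` with (L) replaced by (L♭) `hharm`: every
constrained affine potential has zero constant part): curl-free `X` with vanishing constrained averages is `dφ` with `φ` constant along every constrained bond at the `j`-fold centres.
[cite: Balaban1988Convergent, (2.2) p.255; Balaban1985Variational, Sect. E p.300] -/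
theorem exists_locConstGauge_of_plaq_eq_zero_of_iterLin_eq_zero_of_harmonic
    (Q : (i : ℕ) → (PBond P 0 → Matrix n n ℂ) → PBond P i → Matrix n n ℂ)
    (hQ0 : ∀ Y, Q 0 Y = Y) (hQs : ∀ (i : ℕ) (Y : PBond P 0 → Matrix n n ℂ) (c : PBond P (i + 1)), Q (i + 1) Y c = linAvg (Q i Y) c)
    (𝔅 : BDetSet P) (k : ℕ)
    (hharm : ∀ (φ₀ : Site P 0 → Matrix n n ℂ) (A : Fin P.d → Matrix n n ℂ),
      (∀ j, j ≤ k → ∀ c ∈ (𝔅 j), φ₀ (embIter j c.tgt) - φ₀ (embIter j c.src) + (P.L ^ j : ℕ) • A c.dir = 0) → ∀ μ, A μ = 0)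
    (X : PBond P 0 → Matrix n n ℂ)
    (hcurl : ∀ p : Plaq P 0, X ⟨p.src, p.μ⟩ + X ⟨p.src.shift p.μ, p.ν⟩ - X ⟨p.src.shift p.ν, p.μ⟩ - X ⟨p.src, p.ν⟩ = 0)
    (hQ : ∀ j, j ≤ k → ∀ c ∈ (𝔅 j), Q j X c = 0) :
    ∃ φ : Site P 0 → Matrix n n ℂ, (∀ j, j ≤ k → ∀ c ∈ (𝔅 j), φ (embIter j c.tgt) = φ (embIter j c.src)) ∧
      ∀ b : PBond P 0, X b = φ b.tgt - φ b.src := by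
  obtain ⟨φ₀, A, hX⟩ := exists_grad_add_dirConst_of_plaq_eq_zero_matrix X hcurl
  have hXf : X = fun b : PBond P 0 => (φ₀ b.tgt - φ₀ b.src) + A b.dir := funext hX
  -- `Q^{(j)}X = d(φ₀∘embIter j) + L^j·A₀ = 0` on the constrained bonds, so `A = 0` by (L♭)
  have hk : ∀ j, j ≤ k → ∀ c ∈ (𝔅 j), φ₀ (embIter j c.tgt) - φ₀ (embIter j c.src) + (P.L ^ j : ℕ) • A c.dir = 0 := by
    intro j hj c hc
    have h := hQ j hj c hc
    rwa [hXf, iterLin_add Q hQ0 hQs (fun b : PBond P 0 => φ₀ b.tgt - φ₀ b.src) (fun b => A b.dir) j c,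
      iterLin_grad Q hQ0 hQs (fun i φ y => φ (embIter i y)) (fun φ => rfl) (fun i φ y => rfl) φ₀ j c, iterLin_dirConst Q hQ0 hQs A j c] at h
  have hA : ∀ μ : Fin P.d, A μ = 0 := hharm φ₀ A hk
  refine ⟨φ₀, fun j hj c hc => ?_, fun b => by rw [hX b, hA, add_zero]⟩
  have h := hk j hj c hc
  rwa [hA, smul_zero, add_zero, sub_eq_zero] at h

end

/-! ## §2 (v1.1 edition, hand-typed) ★★★ THE HARMONIC LETTER (L♭) AT PRINT's DATUM `lamBondsSeq Ω k` ([Balaban1984PropagatorsII] (2.3) p. 224) FOR EVERY (N)(B) SEQUENCE, and for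
the record's `Ω := maxDomT M₁ Z`

The letter dag-n12-w6 g24's `…N12ForestSliceLam` §2 (`hharm`) leaves DISPLAYED at print's datum, DISCHARGED in that file's own currency — a sequence `Ω : ℕ → Set T_η` with (N) `Ω_{j+1} ⊆ Ω_j`
(`1 ≤ j < k`) and (B) `Ω_j` a union of `j`-blocks (`1 ≤ j ≤ k`); the separation letter (S) is NOT needed: if `φ(c₊) − φ(c₋) + L^j·A(dir c) = 0` on every bond of PRINT's `Λ_j` (FEWER bonds
than the (b)-reading `bondsOf (genSet Ω k j)`: the inward connectors are not constrained), then `A = 0`.  OBSERVATION (the whole content): the seam induction of the parent's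
`T_shift_add_seam_eq` NEVER reads an inward connector — in each of its three cases the one constrained `a`-bond it uses joins the `a`-blocks of two fine neighbours `z`, `z + e_μ` whose
last scales `n(·) = max{i ≤ k : · ∈ Ω_i}` are BOTH `≤ a`, so neither end-point's `(a+1)`-block is an `(a+1)`-point of `Ω_{a+1}` ((B) at level `a + 1`), i.e. the bond lies in `Λ_a`
(`iterBlockOf_bond_mem_lamBondsSeq`).  §2.1 re-types dag-n12-w3's last-scale bookkeeping (`…FlatHndConnLetter` §3–§4, stated there for `maxDomT`) for an (N)(B) sequence; §2.2 is the
parent's §2∕§4 verbatim over it with the three membership certificates inserted (`T_shift_add_seam_eq_lamBondsSeq`, `sitesPerDir_nsmul_eq_zero_of_constr_lamBondsSeq_nested`,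
★★★ `harmonic_lamBondsSeq_nested`); §2.3 the record's instance `Ω := maxDomT M₁ Z` ((N) `maxDomT_succ_subset`, (B) `isBlockUnion_maxDomT`): ★★★ `harmonic_lamBondsSeq`.
Pure lattice bookkeeping; nothing of Bałaban's estimates; N12 NOT discharged; counts unmoved. -/

section PrintDatumHarmonic

open scoped Classical

open Literature.MathematicalPhysics.QuantumFieldTheory.Balaban1983to89.B14.Eq213DetSet (maxDomT isBlockUnion_maxDomT maxDomT_succ_subset)
open Literature.MathematicalPhysics.QuantumFieldTheory.Balaban1983to89.B14.Eq213MaximalDomains (side)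
open Literature.MathematicalPhysics.QuantumFieldTheory.BalabanImbrieJaffe1984to88.BIJ88RT51Background (iterBlockOf_embIter)
open B6CubeRightLegsV1 (iterBlockOf_shift_or)
open B14.Eq22Determines (IsBlockUnion)
open N12FlatHndConnLetter (blockConst_of_adjacent mem_iff_centre_mem embIter_iterBlockOf_embIter)
open Summit.QuantumFields.YangMills.BalabanUVNodes.N12FlatHndHarmonicLetter (wrap_iff_of_iterBlockOf_shift not_wrap_of_iterBlockOf_shift_eq
  seam_eq_zero_of_shift_law embIter_shift_apply_of_ne)
open Summit.QuantumFields.YangMills.Theorems.Prop7TentInterpolation (val_embIter)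

variable {P : Params} {V : Type*} {n : Type*} {Ω : ℕ → Set (Site P 0)} {k : ℕ}

/-! ### §2.1 Last-scale bookkeeping for an (N)(B) sequence (w3's `…FlatHndConnLetter` §3–§4, re-typed for a general `Ω`) -/

/-- (N) chained: `Ω_j ⊆ Ω_i` for `1 ≤ i ≤ j ≤ k`. [cite: Balaban1988Convergent, (2.13) pp.256-257] -/
theorem subset_of_nested (hnest : ∀ j, 1 ≤ j → j < k → Ω (j + 1) ⊆ Ω j) {i : ℕ} (hi : 1 ≤ i) :
    ∀ {j : ℕ}, i ≤ j → j ≤ k → Ω j ⊆ Ω i := by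
  intro j hij hjk
  obtain ⟨d, rfl⟩ := Nat.exists_eq_add_of_le hij
  induction d with
  | zero => exact subset_rfl
  | succ d ih => exact (hnest (i + d) (by omega) (by omega)).trans (ih (by omega) (by omega))

/-- Above the last scale the site is outside: `n(z) < i ≤ k ⟹ z ∉ Ω_i`. [cite: Balaban1988Convergent, (2.13) pp.256-257] -/
theorem not_mem_of_findGreatest_lt (z : Site P 0) {a i : ℕ} (ha : Nat.findGreatest (fun i => z ∈ Ω i) k = a) (hai : a < i) (hik : i ≤ k) :
    z ∉ Ω i :=
  (Nat.findGreatest_eq_iff.1 ha).2.2 hai hik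

/-- The centre of a member site of positive scale `a ≤ k` (a point of `Γ_a^{(a)}`) lies in `Ω_a`. [cite: Balaban1988Convergent, (2.2) p.255, (2.13) pp.256-257] -/
theorem embIter_mem_of_mem_genSet {a : ℕ} (hpos : 0 < a) (hak : a ≤ k) {y : Site P a} (hy : y ∈ genSet Ω k a) : embIter a y ∈ Ω a := by
  have h : embIter a y ∈ gammaRegion Ω k a := mem_pts.1 (show y ∈ pts a (gammaRegion Ω k a) from hy)
  rcases hak.lt_or_eq with hlt | rfl
  · rw [gammaRegion_mid Ω hpos hlt] at h; exact h.1
  · rw [gammaRegion_self] at h; exact h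

/-- (B) one level up: the `a`-centre of `z`'s `a`-block lies in the `(a+1)`-block union `Ω_{a+1}` iff `z` does (both have the same `(a+1)`-block). [cite: Balaban1988Convergent, (2.1) p.255] -/
theorem centre_mem_iff_of_isBlockUnion_succ {a : ℕ} {X : Set (Site P 0)} (hX : IsBlockUnion (a + 1) X) (haK : a ≤ P.m + P.K) (z : Site P 0) :
    embIter a (iterBlockOf a z) ∈ X ↔ z ∈ X := by
  rw [mem_iff_centre_mem hX (embIter a (iterBlockOf a z)), mem_iff_centre_mem hX z,
    B5Eq118OneStroke.iterBlockOf_succ, B5Eq118OneStroke.iterBlockOf_succ, iterBlockOf_embIter a haK]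

/-- **THE TOP OF A FINE SITE IS A MEMBER SITE** ((N)(B) sequence): with `a = n(z)`, the `a`-block of `z` is a point of `Γ_a^{(a)}` (`genSet Ω k a`).
[cite: Balaban1988Convergent, (2.2) p.255, (2.13) pp.256-257] -/
theorem iterBlockOf_mem_genSet_of_findGreatest_eq (hk : 1 ≤ k) (hkK : k ≤ P.m + P.K) (hBU : ∀ j, 1 ≤ j → j ≤ k → IsBlockUnion j (Ω j))
    (z : Site P 0) {a : ℕ} (ha : Nat.findGreatest (fun i => z ∈ Ω i) k = a) : iterBlockOf a z ∈ genSet Ω k a := by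
  have hak : a ≤ k := ha ▸ Nat.findGreatest_le k
  show iterBlockOf a z ∈ pts a (gammaRegion Ω k a)
  rcases Nat.eq_zero_or_pos a with rfl | hpos
  · rw [gammaRegion_zero Ω hk, B5Eq118OneStroke.iterBlockOf_zero]
    exact not_mem_of_findGreatest_lt z ha Nat.zero_lt_one hk
  · have hctr : embIter a (iterBlockOf a z) ∈ Ω a := (mem_iff_centre_mem (hBU a hpos hak) z).1 ((Nat.findGreatest_eq_iff.1 ha).2.1 hpos.ne')
    rcases hak.lt_or_eq with hlt | rfl
    · rw [gammaRegion_mid Ω hpos hlt]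
      exact mem_pts.2 ⟨hctr, fun hmem => not_mem_of_findGreatest_lt z ha (Nat.lt_succ_self a) hlt
        ((centre_mem_iff_of_isBlockUnion_succ (hBU (a + 1) (Nat.succ_pos a) hlt) (hak.trans hkK) z).1 hmem)⟩
    · rw [gammaRegion_self]; exact mem_pts.2 hctr

/-- Inside a `j`-block disjoint from `Ω_j` (`1 ≤ j ≤ k`) every fine site has last scale `< j` ((N)(B)). [cite: Balaban1988Convergent, (2.13) pp.256-257] -/
theorem findGreatest_lt_of_block_disjoint_seq (hnest : ∀ j, 1 ≤ j → j < k → Ω (j + 1) ⊆ Ω j) (hBU : ∀ j, 1 ≤ j → j ≤ k → IsBlockUnion j (Ω j))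
    {j : ℕ} (hj1 : 1 ≤ j) (hj : j ≤ k) {Y : Site P j} (hY : embIter j Y ∉ Ω j) {z : Site P 0} (hz : iterBlockOf j z = Y) :
    Nat.findGreatest (fun i => z ∈ Ω i) k < j := by
  refine Nat.lt_of_not_le fun hge => hY ?_
  set a := Nat.findGreatest (fun i => z ∈ Ω i) k with ha
  have hzj : z ∈ Ω j := subset_of_nested hnest hj1 hge (Nat.findGreatest_le k) ((Nat.findGreatest_eq_iff.1 ha.symm).2.1 (by omega))
  exact hz ▸ (mem_iff_centre_mem (hBU j hj1 hj) z).1 hzj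

/-- Reading the top potential `T(z) = ψ(ι_{n(z)} B^{n(z)} z)` at a prescribed last scale. [cite: Balaban1988Convergent, (2.13) pp.256-257] -/
theorem T_eq_of_findGreatest_eq_seq (ψ T : Site P 0 → V)
    (hT : ∀ z, T z = ψ (embIter (Nat.findGreatest (fun i => z ∈ Ω i) k) (iterBlockOf (Nat.findGreatest (fun i => z ∈ Ω i) k) z)))
    (z : Site P 0) {a : ℕ} (ha : Nat.findGreatest (fun i => z ∈ Ω i) k = a) : T z = ψ (embIter a (iterBlockOf a z)) := by
  rw [hT z]; cases ha; rfl

/-- `T` at the centre of a `j`-block disjoint from `Ω_j` is `ψ` there (the centre is its own top; (N)(B)). [cite: Balaban1988Convergent, (2.13) pp.256-257] -/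
theorem T_centre_of_block_disjoint_seq (hkK : k ≤ P.m + P.K) (hnest : ∀ j, 1 ≤ j → j < k → Ω (j + 1) ⊆ Ω j)
    (hBU : ∀ j, 1 ≤ j → j ≤ k → IsBlockUnion j (Ω j)) (ψ T : Site P 0 → V)
    (hT : ∀ z, T z = ψ (embIter (Nat.findGreatest (fun i => z ∈ Ω i) k) (iterBlockOf (Nat.findGreatest (fun i => z ∈ Ω i) k) z)))
    {j : ℕ} (hj1 : 1 ≤ j) (hj : j ≤ k) {Y : Site P j} (hY : embIter j Y ∉ Ω j) : T (embIter j Y) = ψ (embIter j Y) := by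
  set a := Nat.findGreatest (fun i => embIter j Y ∈ Ω i) k with ha
  have halt : a < j := findGreatest_lt_of_block_disjoint_seq hnest hBU hj1 hj hY (iterBlockOf_embIter j (hj.trans hkK) Y)
  rw [T_eq_of_findGreatest_eq_seq ψ T hT _ ha.symm, embIter_iterBlockOf_embIter (by omega) halt.le Y]

/-- **PRINT's EXCLUSION AT THE TOPS**: if `n(z) ≤ a < k`, the `(a+1)`-block of `z` is NOT an `(a+1)`-point of `Ω_{a+1}` ((B) at level `a + 1`, `z ∉ Ω_{a+1}`) — the condition [II] (2.3)
puts on both end-points of a bond of `Λ_a`. [cite: Balaban1984PropagatorsII, (2.3) p.224; Balaban1988Convergent, (2.13) pp.256-257] -/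
theorem blockOf_iterBlockOf_not_mem_pts_of_findGreatest_le (hBU : ∀ j, 1 ≤ j → j ≤ k → IsBlockUnion j (Ω j))
    (z : Site P 0) {a : ℕ} (hza : Nat.findGreatest (fun i => z ∈ Ω i) k ≤ a) (hak : a < k) :
    blockOf (iterBlockOf a z) ∉ pts (a + 1) (Ω (a + 1)) := fun h =>
  not_mem_of_findGreatest_lt z rfl (Nat.lt_succ_of_le hza) (Nat.succ_le_of_lt hak)
    ((mem_iff_centre_mem (hBU (a + 1) (Nat.succ_pos a) (Nat.succ_le_of_lt hak)) z).2 (mem_pts.1 h))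

/-- **THE BONDS THE SEAM INDUCTION READS ARE PRINT's**: the `a`-bond from the `a`-block of `z` in direction `μ`, when the `a`-blocks of `z` and `z + e_μ` are adjacent (`hadj`), both last
scales are `≤ a`, and the bond meets `Γ_a^{(a)}` (`hmem`), is a bond of `Λ_a = lamBondsSeq Ω k a` (not an inward connector). [cite: Balaban1984PropagatorsII, (2.3) p.224; Balaban1988Convergent, (2.13) pp.256-257] -/
theorem iterBlockOf_bond_mem_lamBondsSeq (hBU : ∀ j, 1 ≤ j → j ≤ k → IsBlockUnion j (Ω j)) {a : ℕ} (z : Site P 0) (μ : Fin P.d)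
    (hz : Nat.findGreatest (fun i => z ∈ Ω i) k ≤ a) (hz' : Nat.findGreatest (fun i => z.shift μ ∈ Ω i) k ≤ a)
    (hadj : iterBlockOf a (z.shift μ) = (iterBlockOf a z).shift μ) (hmem : (⟨iterBlockOf a z, μ⟩ : PBond P a) ∈ bondsOf (genSet Ω k a)) :
    (⟨iterBlockOf a z, μ⟩ : PBond P a) ∈ lamBondsSeq Ω k a :=
  (mem_lamBondsSeq_iff Ω k _).2 ⟨hmem, fun hak =>
    ⟨blockOf_iterBlockOf_not_mem_pts_of_findGreatest_le hBU z hz hak, by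
      show blockOf ((iterBlockOf a z).shift μ) ∉ pts (a + 1) (Ω (a + 1))
      rw [← hadj]
      exact blockOf_iterBlockOf_not_mem_pts_of_findGreatest_le hBU (z.shift μ) hz' hak⟩⟩

/-! ### §2.2 The seam induction over print's bonds, and the harmonic letter, for every (N)(B) sequence -/

/-- ★★ **CONTINUITY OF THE TOP POTENTIAL UP TO A SEAM MONODROMY, READING ONLY PRINT's BONDS** ((N)(B) sequence, `1 ≤ k ≤ m + K`): if `ψ` is constant along every non-wrapping bond of
`lamBondsSeq Ω k` and jumps by `−w_μ` along the wrapping ones, then `T(z + e_μ) + [z_μ = N₀ − 1]·w_μ = T(z)` on every fine bond — the parent's `T_shift_add_seam_eq` induction verbatim;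
at each of its three uses of `hψ` the bond is certified PRINT's by `iterBlockOf_bond_mem_lamBondsSeq`. [cite: Balaban1984PropagatorsII, (2.3) p.224; Balaban1988Convergent, (2.2) p.255, (2.13) pp.256-257] -/
theorem T_shift_add_seam_eq_lamBondsSeq [AddCommGroup V] (hk : 1 ≤ k) (hkK : k ≤ P.m + P.K)
    (hnest : ∀ j, 1 ≤ j → j < k → Ω (j + 1) ⊆ Ω j) (hBU : ∀ j, 1 ≤ j → j ≤ k → IsBlockUnion j (Ω j))
    (ψ : Site P 0 → V) (T : Site P 0 → V)
    (hT : ∀ z, T z = ψ (embIter (Nat.findGreatest (fun i => z ∈ Ω i) k) (iterBlockOf (Nat.findGreatest (fun i => z ∈ Ω i) k) z)))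
    (w : Fin P.d → V)
    (hψ : ∀ j, j ≤ k → ∀ c ∈ lamBondsSeq Ω k j, ψ (embIter j c.tgt) + (if (c.src c.dir).val + 1 = P.sitesPerDir j then w c.dir else 0) = ψ (embIter j c.src)) :
    ∀ (i : ℕ) (z : Site P 0) (μ : Fin P.d), Nat.findGreatest (fun i => z ∈ Ω i) k < i → Nat.findGreatest (fun i => z.shift μ ∈ Ω i) k < i →
      T (z.shift μ) + (if (z μ).val + 1 = P.sitesPerDir 0 then w μ else 0) = T z := by
  intro i
  induction i using Nat.strong_induction_on with | _ i ih => ?_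
  intro z μ hzi hz'i
  -- constancy of `T` on every `j`-block disjoint from `Ω_j`, `1 ≤ j < i`, `j ≤ k` (in-block steps do not wrap)
  have hblock : ∀ j, 1 ≤ j → j < i → j ≤ k → ∀ (Y : Site P j), embIter j Y ∉ Ω j →
      ∀ u u' : Site P 0, iterBlockOf j u = Y → iterBlockOf j u' = Y → T u = T u' := by
    refine fun j hj1 hji hjk Y hY u u' hu hu' => blockConst_of_adjacent (hjk.trans hkK) Y T (fun x ν hx hxν => ?_) hu hu'
    have h := ih j hji x ν (findGreatest_lt_of_block_disjoint_seq hnest hBU hj1 hjk hY hx) (findGreatest_lt_of_block_disjoint_seq hnest hBU hj1 hjk hY hxν)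
    rwa [if_neg (not_wrap_of_iterBlockOf_shift_eq (hjk.trans hkK) x ν (hxν.trans hx.symm)), add_zero] at h
  set a := Nat.findGreatest (fun i => z ∈ Ω i) k with ha
  set a' := Nat.findGreatest (fun i => z.shift μ ∈ Ω i) k with ha'
  have hak : a ≤ k := Nat.findGreatest_le k
  have ha'k : a' ≤ k := Nat.findGreatest_le k
  have htop : iterBlockOf a z ∈ genSet Ω k a := iterBlockOf_mem_genSet_of_findGreatest_eq hk hkK hBU z ha.symm
  have htop' : iterBlockOf a' (z.shift μ) ∈ genSet Ω k a' := iterBlockOf_mem_genSet_of_findGreatest_eq hk hkK hBU (z.shift μ) ha'.symm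
  rcases lt_trichotomy a a' with hlt | heq | hgt
  · -- `a < a'`: the OUTWARD connector at level `a'` from the outer neighbour block `Y ∋ z` to the member block of `z + e_μ` — a bond of `Λ_{a'}`
    have ha'1 : 1 ≤ a' := by omega
    have hY : embIter a' (iterBlockOf a' z) ∉ Ω a' := fun h => not_mem_of_findGreatest_lt z ha.symm hlt ha'k ((mem_iff_centre_mem (hBU a' ha'1 ha'k) z).2 h)
    have hY'in : embIter a' (iterBlockOf a' (z.shift μ)) ∈ Ω a' := embIter_mem_of_mem_genSet ha'1 ha'k htop'
    have hadj : iterBlockOf a' (z.shift μ) = (iterBlockOf a' z).shift μ := (iterBlockOf_shift_or a' (ha'k.trans hkK) z μ).resolve_left fun h => absurd (h ▸ hY'in) hY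
    have hbond := hψ a' ha'k ⟨iterBlockOf a' z, μ⟩
      (iterBlockOf_bond_mem_lamBondsSeq hBU z μ (ha.symm.le.trans hlt.le) ha'.symm.le hadj (Or.inr (show (iterBlockOf a' z).shift μ ∈ _ by rw [← hadj]; exact htop')))
    rw [if_congr (wrap_iff_of_iterBlockOf_shift (ha'k.trans hkK) z μ hadj) rfl rfl] at hbond
    calc T (z.shift μ) + (if (z μ).val + 1 = P.sitesPerDir 0 then w μ else 0)
        = ψ (embIter a' (iterBlockOf a' (z.shift μ))) + (if (z μ).val + 1 = P.sitesPerDir 0 then w μ else 0) := by rw [T_eq_of_findGreatest_eq_seq ψ T hT _ ha'.symm]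
      _ = ψ (embIter a' (iterBlockOf a' z)) := by rw [hadj]; exact hbond
      _ = T (embIter a' (iterBlockOf a' z)) := (T_centre_of_block_disjoint_seq hkK hnest hBU ψ T hT ha'1 ha'k hY).symm
      _ = T z := hblock a' ha'1 hz'i ha'k (iterBlockOf a' z) hY _ _ (iterBlockOf_embIter a' (ha'k.trans hkK) _) rfl
  · -- `a = a'`: the two member blocks are equal (an in-block step: no seam) or adjacent (one bond of `Λ_a` between two members)
    have hT' : T (z.shift μ) = ψ (embIter a (iterBlockOf a (z.shift μ))) := T_eq_of_findGreatest_eq_seq ψ T hT _ (ha'.symm.trans heq.symm)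
    rw [hT', T_eq_of_findGreatest_eq_seq ψ T hT z ha.symm]
    rcases iterBlockOf_shift_or a (hak.trans hkK) z μ with h | h
    · rw [h, if_neg (not_wrap_of_iterBlockOf_shift_eq (hak.trans hkK) z μ h), add_zero]
    · have hbond := hψ a hak ⟨iterBlockOf a z, μ⟩
        (iterBlockOf_bond_mem_lamBondsSeq hBU z μ ha.symm.le (ha'.symm.le.trans heq.symm.le) h (Or.inl htop))
      rw [if_congr (wrap_iff_of_iterBlockOf_shift (hak.trans hkK) z μ h) rfl rfl] at hbond
      rw [h]; exact hbond
  · -- `a' < a`: symmetric to the first case (the outward connector at level `a`)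
    have ha1 : 1 ≤ a := by omega
    have hY' : embIter a (iterBlockOf a (z.shift μ)) ∉ Ω a := fun h =>
      not_mem_of_findGreatest_lt (z.shift μ) ha'.symm hgt hak ((mem_iff_centre_mem (hBU a ha1 hak) (z.shift μ)).2 h)
    have hYin : embIter a (iterBlockOf a z) ∈ Ω a := embIter_mem_of_mem_genSet ha1 hak htop
    have hadj : iterBlockOf a (z.shift μ) = (iterBlockOf a z).shift μ := (iterBlockOf_shift_or a (hak.trans hkK) z μ).resolve_left fun h => absurd (h ▸ hYin) hY'
    have hbond := hψ a hak ⟨iterBlockOf a z, μ⟩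
      (iterBlockOf_bond_mem_lamBondsSeq hBU z μ ha.symm.le (ha'.symm.le.trans hgt.le) hadj (Or.inl htop))
    rw [if_congr (wrap_iff_of_iterBlockOf_shift (hak.trans hkK) z μ hadj) rfl rfl] at hbond
    calc T (z.shift μ) + (if (z μ).val + 1 = P.sitesPerDir 0 then w μ else 0)
        = ψ (embIter a (iterBlockOf a (z.shift μ))) + (if (z μ).val + 1 = P.sitesPerDir 0 then w μ else 0) := by
          rw [hblock a ha1 hzi hak (iterBlockOf a (z.shift μ)) hY' _ _ rfl (iterBlockOf_embIter a (hak.trans hkK) _), T_centre_of_block_disjoint_seq hkK hnest hBU ψ T hT ha1 hak hY']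
      _ = ψ (embIter a (iterBlockOf a z)) := by rw [hadj]; exact hbond
      _ = T z := (T_eq_of_findGreatest_eq_seq ψ T hT z ha.symm).symm

/-- ★★★ **THE HARMONIC LETTER AT PRINT's DATUM, TIMES `N₀`, EVERY (N)(B) SEQUENCE**: `φ(c₊) − φ(c₋) + L^j·A(dir c) = 0` on every bond of `Λ_j = lamBondsSeq Ω k j`, `j ≤ k`, forces
`N₀·A_μ = 0` — the parent's `sitesPerDir_nsmul_eq_zero_of_constr_Bj` verbatim over `T_shift_add_seam_eq_lamBondsSeq` (`Ψ = φ + Σ_ν x_ν·A_ν`; once around the fine torus).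
[cite: Balaban1984PropagatorsII, (2.3) p.224; Balaban1988Convergent, (2.2) p.255, (2.13) pp.256-257] -/
theorem sitesPerDir_nsmul_eq_zero_of_constr_lamBondsSeq_nested [AddCommGroup V] (hk : 1 ≤ k) (hkK : k ≤ P.m + P.K)
    (hnest : ∀ j, 1 ≤ j → j < k → Ω (j + 1) ⊆ Ω j) (hBU : ∀ j, 1 ≤ j → j ≤ k → IsBlockUnion j (Ω j))
    (φ : Site P 0 → V) (A : Fin P.d → V)
    (hφ : ∀ j, j ≤ k → ∀ c ∈ lamBondsSeq Ω k j, φ (embIter j c.tgt) - φ (embIter j c.src) + (P.L ^ j) • A c.dir = 0) (μ : Fin P.d) :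
    P.sitesPerDir 0 • A μ = 0 := by
  set Λ : Site P 0 → V := fun x => ∑ ν, (x ν).val • A ν with hΛ
  obtain ⟨T, hT⟩ : ∃ T : Site P 0 → V, ∀ z, T z = (fun x => φ x + Λ x) (embIter (Nat.findGreatest (fun i => z ∈ Ω i) k)
      (iterBlockOf (Nat.findGreatest (fun i => z ∈ Ω i) k) z)) := ⟨_, fun _ => rfl⟩
  refine seam_eq_zero_of_shift_law T (fun ν => P.sitesPerDir 0 • A ν) (fun z ν =>
    T_shift_add_seam_eq_lamBondsSeq hk hkK hnest hBU (fun x => φ x + Λ x) T hT (fun ν => P.sitesPerDir 0 • A ν) ?_ (k + 1) z ν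
      (Nat.lt_succ_of_le (Nat.findGreatest_le k)) (Nat.lt_succ_of_le (Nat.findGreatest_le k))) μ
  -- `Ψ` along a print bond `c = (y, μ')` of level `j`
  rintro j hj ⟨y, μ'⟩ hc
  have hjK : j ≤ P.m + P.K := hj.trans hkK
  have key := hφ j hj ⟨y, μ'⟩ hc
  have hN0 : P.sitesPerDir 0 = P.sitesPerDir j * P.L ^ j := sitesPerDir_zero_eq_mul_pow hjK
  -- the label potential moves only in the `μ'`-slot
  have hΛdiff : ∀ x x' : Site P 0, (∀ ν, ν ≠ μ' → x' ν = x ν) → Λ x' + (x μ').val • A μ' = Λ x + (x' μ').val • A μ' := by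
    intro x x' hxx'
    simp only [hΛ]
    rw [← Finset.sum_erase_add _ _ (Finset.mem_univ μ'), ← Finset.sum_erase_add _ _ (Finset.mem_univ μ'),
      Finset.sum_congr rfl fun ν hν => by rw [hxx' ν (Finset.ne_of_mem_erase hν)]]
    abel
  have hΛc := hΛdiff (embIter j y) (embIter j (y.shift μ')) fun ν hν => embIter_shift_apply_of_ne hjK y hν
  rw [val_embIter hjK, val_embIter hjK, val_shift_self'] at hΛc
  show φ (embIter j (y.shift μ')) + Λ (embIter j (y.shift μ')) + (if (y μ').val + 1 = P.sitesPerDir j then P.sitesPerDir 0 • A μ' else 0) =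
    φ (embIter j y) + Λ (embIter j y)
  change φ (embIter j (y.shift μ')) - φ (embIter j y) + P.L ^ j • A μ' = 0 at key
  have hφ' : φ (embIter j (y.shift μ')) = φ (embIter j y) - P.L ^ j • A μ' := by rw [← sub_eq_zero, ← key]; abel
  by_cases hw : (y μ').val + 1 = P.sitesPerDir j
  · -- wrapping bond: the label drops from `(N_j − 1)·L^j + c` to `c`
    have hmod : ((y μ').val + 1) % P.sitesPerDir j = 0 := by rw [hw, Nat.mod_self]
    rw [hmod, zero_mul, zero_add, add_smul] at hΛc
    have hΛc' : Λ (embIter j (y.shift μ')) = Λ (embIter j y) - ((y μ').val * P.L ^ j) • A μ' :=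
      calc Λ (embIter j (y.shift μ'))
          = Λ (embIter j (y.shift μ')) + (((y μ').val * P.L ^ j) • A μ' + ((P.L ^ j - 1) / 2) • A μ') - (((y μ').val * P.L ^ j) • A μ' + ((P.L ^ j - 1) / 2) • A μ') := by abel
        _ = Λ (embIter j y) - ((y μ').val * P.L ^ j) • A μ' := by rw [hΛc]; abel
    have hN0' : P.sitesPerDir 0 = (y μ').val * P.L ^ j + P.L ^ j :=
      calc P.sitesPerDir 0 = P.sitesPerDir j * P.L ^ j := hN0
        _ = ((y μ').val + 1) * P.L ^ j := by rw [hw]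
        _ = (y μ').val * P.L ^ j + P.L ^ j := add_one_mul _ _
    rw [if_pos hw, hN0', add_smul, hΛc', hφ']
    abel
  · -- non-wrapping bond: the label grows by `L^j`
    have hlt : (y μ').val + 1 < P.sitesPerDir j := lt_of_le_of_ne (ZMod.val_lt _) hw
    rw [Nat.mod_eq_of_lt hlt, Nat.add_mul, one_mul] at hΛc
    have hΛc' : Λ (embIter j (y.shift μ')) = Λ (embIter j y) + P.L ^ j • A μ' :=
      calc Λ (embIter j (y.shift μ'))
          = Λ (embIter j (y.shift μ')) + ((y μ').val * P.L ^ j + (P.L ^ j - 1) / 2) • A μ' - ((y μ').val * P.L ^ j + (P.L ^ j - 1) / 2) • A μ' := by abel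
        _ = Λ (embIter j y) + P.L ^ j • A μ' := by rw [hΛc, add_smul, add_smul, add_smul]; abel
    rw [if_neg hw, add_zero, hΛc', hφ']
    abel

/-- ★★★ **THE HARMONIC LETTER (L♭) AT PRINT's DATUM `lamBondsSeq Ω k`, EVERY (N)(B) SEQUENCE** (matrix-valued; `N₀ ≠ 0` in `ℂ`; (S) not needed): a constrained affine potential on PRINT's bonds
has zero constant part.  This IS the binder `hharm` of dag-n12-w6's `…N12ForestSliceLam.eq_zero_of_fderiv_msChartB_one_eq_zero_of_forest_lamBondsSeq_nested` ∕ `deriv_deriv_pos_…` ∕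
`hnondeg_real_flat_forest_lamBondsSeq_nested`, supplied by name as `harmonic_lamBondsSeq_nested hk1 hk hnest hBU` from the (N)(B) letters those theorems already carry.
[cite: Balaban1984PropagatorsII, (2.3) p.224; Balaban1988Convergent, (2.2) p.255, (2.13) pp.256-257] -/
theorem harmonic_lamBondsSeq_nested (hk : 1 ≤ k) (hkK : k ≤ P.m + P.K)
    (hnest : ∀ j, 1 ≤ j → j < k → Ω (j + 1) ⊆ Ω j) (hBU : ∀ j, 1 ≤ j → j ≤ k → IsBlockUnion j (Ω j))
    (φ₀ : Site P 0 → Matrix n n ℂ) (A : Fin P.d → Matrix n n ℂ)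
    (hφ : ∀ j, j ≤ k → ∀ c ∈ lamBondsSeq Ω k j, φ₀ (embIter j c.tgt) - φ₀ (embIter j c.src) + (P.L ^ j : ℕ) • A c.dir = 0) (μ : Fin P.d) :
    A μ = 0 := by
  have h := sitesPerDir_nsmul_eq_zero_of_constr_lamBondsSeq_nested hk hkK hnest hBU φ₀ A hφ μ
  rw [← Nat.cast_smul_eq_nsmul ℂ, smul_eq_zero] at h
  exact h.resolve_left (Nat.cast_ne_zero.mpr (P.sitesPerDir_ne_zero 0))

/-! ### §2.3 The record's sequence `Ω := maxDomT M₁ Z` ((N) `maxDomT_succ_subset`, (B) `isBlockUnion_maxDomT`) -/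

section Record

variable {M₁ : ℕ} {Z : Set (Site P 0)}

/-- ★★★ **THE HARMONIC LETTER AT PRINT's DATUM OF THE RECORD, TIMES `N₀`** (`Ω := maxDomT M₁ Z`, every `Z`; hypotheses `1 ≤ M₁`, `1 ≤ k ≤ m + K`, cover divisibility — the parent's).
[cite: Balaban1984PropagatorsII, (2.3) p.224; Balaban1988Convergent, (2.2) p.255, (2.13) pp.256-257] -/
theorem sitesPerDir_nsmul_eq_zero_of_constr_lamBondsSeq [AddCommGroup V] (hM : 1 ≤ M₁) (hk : 1 ≤ k) (hkK : k ≤ P.m + P.K)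
    (hdiv : side P.L M₁ k ∣ P.sitesPerDir 0) (φ : Site P 0 → V) (A : Fin P.d → V)
    (hφ : ∀ j, j ≤ k → ∀ c ∈ lamBondsSeq (maxDomT M₁ Z) k j, φ (embIter j c.tgt) - φ (embIter j c.src) + (P.L ^ j) • A c.dir = 0) (μ : Fin P.d) :
    P.sitesPerDir 0 • A μ = 0 :=
  sitesPerDir_nsmul_eq_zero_of_constr_lamBondsSeq_nested hk hkK (fun j _ _ => maxDomT_succ_subset hM Z j)
    (fun _ hj1 hjk => isBlockUnion_maxDomT hM hdiv hj1 hjk (hjk.trans hkK)) φ A hφ μ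

/-- ★★★ **THE HARMONIC LETTER (L♭) AT PRINT's DATUM OF THE RECORD `lamBondsSeq (maxDomT M₁ Z) k`, EVERY `Z`**: a constrained affine potential on print's bonds has zero constant part — the
`hharm` binder of dag-n12-w6's `…N12ForestSliceLam` §2 at `Ω := maxDomT M₁ Z`, by name `harmonic_lamBondsSeq hM hk hkK hdiv`. [cite: Balaban1984PropagatorsII, (2.3) p.224; Balaban1988Convergent, (2.2) p.255, (2.13) pp.256-257] -/
theorem harmonic_lamBondsSeq (hM : 1 ≤ M₁) (hk : 1 ≤ k) (hkK : k ≤ P.m + P.K) (hdiv : side P.L M₁ k ∣ P.sitesPerDir 0)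
    (φ₀ : Site P 0 → Matrix n n ℂ) (A : Fin P.d → Matrix n n ℂ)
    (hφ : ∀ j, j ≤ k → ∀ c ∈ lamBondsSeq (maxDomT M₁ Z) k j, φ₀ (embIter j c.tgt) - φ₀ (embIter j c.src) + (P.L ^ j : ℕ) • A c.dir = 0) (μ : Fin P.d) :
    A μ = 0 :=
  harmonic_lamBondsSeq_nested hk hkK (fun j _ _ => maxDomT_succ_subset hM Z j)
    (fun _ hj1 hjk => isBlockUnion_maxDomT hM hdiv hj1 hjk (hjk.trans hkK)) φ₀ A hφ μ

end Record

end PrintDatumHarmonic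

end Summit.QuantumFields.YangMills.BalabanUVNodes.N12FlatHndHarmonicLetterB

end
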